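import Mathlib
import Summits.MatrixMultiplication.Statement
import Summits.MatrixMultiplication.MatrixMultiplication.Theorems.GraphEquationsDeflation
import Literature.Computability.AlgebraicComplexity.ArithCircuitProofs
import Literature.Computability.AlgebraicComplexity.CircuitGateSemantics

/-!
# Graph equations: forward-mode differentiation of a straight-line program (the blocks)

Route `GraphEquations`, crux `MultiplicityReduction` (line `purisplit`, stub BOP′ at `K = 2`).
First half of the proof of the ROUTINE hypothesis `ForwardModeAD` of `GraphEquationsDeflation`
(forward-mode / Wengert differentiation of a straight-line program along the derivation
`D_μ = Σ_q ι(μ_q) ∂/∂c_q`; Wengert 1964, Baur–Strassen 1983, BCS97 §7.1) on the tree model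
`ArithCircuit`:

* program lemmas (`getD_gateValues_eq_eval_take` = the `getD` form of the trunk
  `ArithCircuit.gateValues_getElem?`, `Operand.eval_append_of_refsBelow`; prefixes are the trunk
  `ArithCircuit.gateValues_take_eq_take` and the in-summit `EqSystem.gateValues_prefix` /
  `EqSystem.getD_gateValues_append`; appending a program with shifted references is
  `ArithCircuit.gateValues_append_shift` of `Literature/…/ConstantFreeCircuits`);
* `D_μ` on generators and linear combinations (`derivC_X_inr : D_μ c_q = ι(μ_q)`, `derivC_X_inl`,
  `derivC_C`, `derivC_smul`, `derivC_list_sum_smul`);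
* the construction: every gate `v_i` receives a block of exactly three gates whose LAST one holds
  `D_μ v_i` (`dOp`, `dBlock`, `dBlocks`: a sum gate ↦ the same linear combination of the
  derivatives; a product `u·w ↦ Du·w, u·Dw, their sum`; `D a_• = D b_• = D const = 0`,
  `D c_q = ι(μ_q)` read through the operand `μOp q`), its size (`dBlocks_length = 3m`) and fan-in
  (`fanIn_of_mem_dBlocks`), and the semantic invariant `getD_dBlocks`: for a well-formed fan-in-two
  program `gs` placed at the front of `pre` (`|pre| = base`), after the blocks of the first `m`
  gates the derivative of gate `i < m` sits at position `base + 3i + 2`.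

The system-level packaging (`adSystem`, `forwardModeAD`) is `GraphEquationsForwardAD`.  No sorry.
-/

-- dupNamespace: forced by the nested Summit.MatrixMultiplication.MatrixMultiplication layout (D-0017)
set_option linter.dupNamespace false

noncomputable section

open scoped BigOperators

namespace Summit.MatrixMultiplication.MatrixMultiplication.Theorems.GraphEquations

open MvPolynomial Literature.Computability.AlgebraicComplexity
open Literature.Computability.AlgebraicComplexity.ArithCircuit

variable {n : ℕ}

/-! ## Generic straight-line-program lemmas -/

section SLP

variable {k : Type*} {σ : Type*} [CommSemiring k]

/-- Gate `m` is evaluated against the values of the gates before it. -/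
theorem getD_gateValues_eq_eval_take (gs : List (Gate k σ)) {m : ℕ} (hm : m < gs.length) :
    (gateValues gs).getD m 0 = gs[m].eval (gateValues (gs.take m)) := by
  rw [List.getD_eq_getElem?_getD, gateValues_getElem? gs m _ (List.getElem?_eq_getElem hm), Option.getD_some]

/-- An operand referencing only gates below `|vals|` ignores appended values. -/
theorem Operand.eval_append_of_refsBelow {vals : List (MvPolynomial σ k)} (ws : List (MvPolynomial σ k))
    {u : Operand k σ} (hu : u.RefsBelow vals.length) : u.eval (vals ++ ws) = u.eval vals := by
  cases u with
  | var i => rfl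
  | const c => rfl
  | gate j =>
    simp only [Operand.RefsBelow] at hu
    simp [Operand.eval, List.getD_eq_getElem?_getD, List.getElem?_append_left (by simpa using hu)]

end SLP

/-! ## The derivation `D_μ` on generators and linear combinations -/

/-- `D_μ` kills constants. -/
theorem derivC_C (μ : Fin n × Fin n → MvPolynomial (MatMulVars n) ℂ) (c : ℂ) : derivC μ (C c) = 0 := by
  simp [derivC]

/-- `D_μ 1 = 0`. -/
theorem derivC_one (μ : Fin n × Fin n → MvPolynomial (MatMulVars n) ℂ) : derivC μ 1 = 0 := by
  rw [← C_1]; exact derivC_C μ 1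

/-- `D_μ a_v = D_μ b_v = 0`. -/
theorem derivC_X_inl (μ : Fin n × Fin n → MvPolynomial (MatMulVars n) ℂ) (v : MatMulVars n) :
    derivC μ (X (Sum.inl v) : MvPolynomial (GraphVars n) ℂ) = 0 := by
  unfold derivC
  exact Finset.sum_eq_zero fun q _ => by rw [pderiv_X_of_ne Sum.inl_ne_inr, mul_zero]

/-- `D_μ c_q = ι(μ_q)`. -/
theorem derivC_X_inr (μ : Fin n × Fin n → MvPolynomial (MatMulVars n) ℂ) (q : Fin n × Fin n) :
    derivC μ (X (Sum.inr q) : MvPolynomial (GraphVars n) ℂ) = liftAB n (μ q) := by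
  unfold derivC
  rw [Finset.sum_eq_single q]
  · rw [pderiv_X_self, mul_one]
  · intro q' _ hq'
    rw [pderiv_X_of_ne (fun h => hq' (Sum.inr_injective h).symm), mul_zero]
  · intro h; exact absurd (Finset.mem_univ q) h

/-- `D_μ` commutes with scalars. -/
theorem derivC_smul (μ : Fin n × Fin n → MvPolynomial (MatMulVars n) ℂ) (c : ℂ)
    (u : MvPolynomial (GraphVars n) ℂ) : derivC μ (c • u) = c • derivC μ u := by
  rw [smul_eq_C_mul, smul_eq_C_mul, derivC_mul, derivC_C, zero_mul, zero_add]

/-- `D_μ` of a linear combination given as a list. -/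
theorem derivC_list_sum_smul (μ : Fin n × Fin n → MvPolynomial (MatMulVars n) ℂ) {ι : Type*}
    (l : List ι) (c : ι → ℂ) (f : ι → MvPolynomial (GraphVars n) ℂ) :
    derivC μ (l.map fun a => c a • f a).sum = (l.map fun a => c a • derivC μ (f a)).sum := by
  induction l with
  | nil => simp
  | cons a l ih => rw [List.map_cons, List.map_cons, List.sum_cons, List.sum_cons, derivC_add, derivC_smul, ih]


section SLP2

variable {k : Type*} {σ : Type*} [CommSemiring k]

/-- Three more gates: the value list grows by their three values, each computed from the earlier ones. -/
theorem gateValues_append_three (l : List (Gate k σ)) (a b c : Gate k σ) :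
    gateValues (l ++ [a, b, c]) =
      gateValues l ++ [a.eval (gateValues l), b.eval (gateValues l ++ [a.eval (gateValues l)]),
        c.eval (gateValues l ++ [a.eval (gateValues l), b.eval (gateValues l ++ [a.eval (gateValues l)])])] := by
  rw [show l ++ [a, b, c] = l ++ [a] ++ [b] ++ [c] by simp, gateValues_append_singleton,
    gateValues_append_singleton, gateValues_append_singleton]
  simp [List.append_assoc]

/-- Reading the third of three appended values. -/
theorem getD_append_three (V : List (MvPolynomial σ k)) (x₁ x₂ x₃ : MvPolynomial σ k) :
    (V ++ [x₁, x₂, x₃]).getD (V.length + 2) 0 = x₃ := by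
  simp [List.getD_eq_getElem?_getD]

/-- Reading the first of two appended values. -/
theorem getD_append_two_fst (V : List (MvPolynomial σ k)) (x₁ x₂ : MvPolynomial σ k) :
    (V ++ [x₁, x₂]).getD V.length 0 = x₁ := by
  simp [List.getD_eq_getElem?_getD]

/-- Reading the second of two appended values. -/
theorem getD_append_two_snd (V : List (MvPolynomial σ k)) (x₁ x₂ : MvPolynomial σ k) :
    (V ++ [x₁, x₂]).getD (V.length + 1) 0 = x₂ := by
  simp [List.getD_eq_getElem?_getD]

end SLP2

/-! ## The differentiated program: three gates per gate -/

section AD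

variable (base : ℕ) (μOp : Fin n × Fin n → Operand ℂ (GraphVars n))

/-- The operand holding `D_μ` of an operand: `D a_• = D b_• = D const = 0`, `D c_q = ι(μ_q)` (the
operand `μOp q`), and the derivative of gate `j` sits at `base + 3j + 2`. -/
def dOp : Operand ℂ (GraphVars n) → Operand ℂ (GraphVars n)
  | .var (Sum.inl _) => .const 0
  | .var (Sum.inr q) => μOp q
  | .const _ => .const 0
  | .gate j => .gate (base + 3 * j + 2)

/-- The gate with value `0` (padding, so that every block has exactly three gates). -/
def zeroGate : Gate ℂ (GraphVars n) := .sum []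

/-- The block of three gates differentiating gate number `i` (forward mode: a sum gate ↦ the same
linear combination of the derivatives; `u·w ↦ Du·w, u·Dw, Du·w + u·Dw`); the LAST gate of the
block holds the derivative. -/
def dBlock (i : ℕ) : Gate ℂ (GraphVars n) → List (Gate ℂ (GraphVars n))
  | .sum args => [zeroGate, zeroGate, .sum (args.map fun a => (a.1, dOp base μOp a.2))]
  | .prod [] => [zeroGate, zeroGate, zeroGate]
  | .prod [u] => [zeroGate, zeroGate, .sum [(1, dOp base μOp u)]]
  | .prod [u, w] => [.prod [dOp base μOp u, w], .prod [u, dOp base μOp w],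
      .sum [(1, .gate (base + 3 * i)), (1, .gate (base + 3 * i + 1))]]
  | .prod (_ :: _ :: _ :: _) => [zeroGate, zeroGate, zeroGate]

/-- Every block has exactly three gates. -/
theorem dBlock_length (i : ℕ) (g : Gate ℂ (GraphVars n)) : (dBlock base μOp i g).length = 3 := by
  rcases g with ⟨args⟩ | ⟨_ | ⟨u, _ | ⟨w, _ | ⟨x, rest⟩⟩⟩⟩ <;> rfl

/-- The blocks of the first `m` gates of `gs`, in order. -/
def dBlocks (gs : List (Gate ℂ (GraphVars n))) : ℕ → List (Gate ℂ (GraphVars n))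
  | 0 => []
  | m + 1 => dBlocks gs m ++ dBlock base μOp m (gs.getD m zeroGate)

/-- `3m` gates for `m` blocks. -/
theorem dBlocks_length (gs : List (Gate ℂ (GraphVars n))) (m : ℕ) :
    (dBlocks base μOp gs m).length = 3 * m := by
  induction m with
  | zero => rfl
  | succ m ih => simp [dBlocks, ih, dBlock_length]; ring

/-- The gates of a block have fan-in at most two if the differentiated gate has. -/
theorem fanIn_of_mem_dBlock {i : ℕ} {g g' : Gate ℂ (GraphVars n)} (hg : g.fanIn ≤ 2)
    (h : g' ∈ dBlock base μOp i g) : g'.fanIn ≤ 2 := by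
  rcases g with ⟨args⟩ | ⟨_ | ⟨u, _ | ⟨w, _ | ⟨x, rest⟩⟩⟩⟩ <;>
    simp only [dBlock, List.mem_cons, List.not_mem_nil, or_false] at h <;>
    rcases h with rfl | rfl | rfl <;>
    simp_all [zeroGate, Gate.fanIn, Gate.args]

/-- All gates of all blocks have fan-in at most two. -/
theorem fanIn_of_mem_dBlocks {gs : List (Gate ℂ (GraphVars n))} (hgs : ∀ g ∈ gs, g.fanIn ≤ 2) {m : ℕ}
    {g' : Gate ℂ (GraphVars n)} (h : g' ∈ dBlocks base μOp gs m) : g'.fanIn ≤ 2 := by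
  induction m with
  | zero => simp [dBlocks] at h
  | succ m ih =>
    simp only [dBlocks, List.mem_append] at h
    rcases h with h | h
    · exact ih h
    · refine fanIn_of_mem_dBlock base μOp ?_ h
      rw [List.getD_eq_getElem?_getD]
      cases hgm : gs[m]? with
      | none => simp [zeroGate, Gate.fanIn, Gate.args]
      | some g => simpa using hgs g (List.mem_of_getElem? hgm)

variable {base μOp}

/-- **ONE BLOCK.**  If below `m` the invariant holds (the derivative of gate `j < m` sits at
`base + 3j + 2`), then the block of gate `m` puts `D_μ v_m` at `base + 3m + 2`.  Hypotheses: `gs`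
(the program of `E`) is well formed and fan-in two, `pre = gs ++ _` has length `base`, and `μOp q`
reads `ι(μ_q)` off the values of `pre`. -/
theorem getD_dBlock_step (μ : Fin n × Fin n → MvPolynomial (MatMulVars n) ℂ)
    {gs pre : List (Gate ℂ (GraphVars n))}
    (hwf : ∀ (i : ℕ) (g : Gate ℂ (GraphVars n)), gs[i]? = some g → ∀ u ∈ g.args, u.RefsBelow i)
    (hfan : ∀ g ∈ gs, g.fanIn ≤ 2) (hpre : ∃ t, pre = gs ++ t) (hlen : pre.length = base)
    (hμ : ∀ q ws, (μOp q).eval (gateValues pre ++ ws) = liftAB n (μ q)) {m : ℕ} (hm : m < gs.length)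
    (ih : ∀ j < m, (gateValues (pre ++ dBlocks base μOp gs m)).getD (base + 3 * j + 2) 0 =
      derivC μ ((gateValues gs).getD j 0)) :
    (gateValues (pre ++ dBlocks base μOp gs m ++ dBlock base μOp m gs[m])).getD (base + 3 * m + 2) 0 =
      derivC μ ((gateValues gs).getD m 0) := by
  obtain ⟨V0, hV0⟩ : ∃ V0, V0 = gateValues (pre ++ dBlocks base μOp gs m) := ⟨_, rfl⟩
  have hlen0 : V0.length = base + 3 * m := by simp [hV0, hlen, dBlocks_length]
  obtain ⟨t, rfl⟩ := hpre
  have hlenm : (gateValues (gs.take m)).length = m := by simp [hm.le]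
  have hV0pre : ∃ r, V0 = gateValues (gs.take m) ++ r := by
    obtain ⟨r1, hr1⟩ := EqSystem.gateValues_prefix gs (t ++ dBlocks base μOp gs m)
    refine ⟨(gateValues gs).drop m ++ r1, ?_⟩
    rw [hV0, List.append_assoc, hr1, gateValues_take_eq_take, ← List.append_assoc, List.take_append_drop]
  have hVpre : ∃ r, V0 = gateValues (gs ++ t) ++ r := by
    obtain ⟨r, hr⟩ := EqSystem.gateValues_prefix (gs ++ t) (dBlocks base μOp gs m)
    exact ⟨r, hV0.trans hr⟩
  have hwf' := hwf m gs[m] (List.getElem?_eq_getElem hm)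
  have hfan' := hfan gs[m] (List.getElem_mem hm)
  have hA : ∀ u ∈ (gs[m]).args, ∀ ws, u.eval (V0 ++ ws) = u.eval (gateValues (gs.take m)) := by
    intro u hu ws
    obtain ⟨r, hr⟩ := hV0pre
    rw [hr, List.append_assoc]
    exact Operand.eval_append_of_refsBelow _ (by rw [hlenm]; exact hwf' u hu)
  have hB : ∀ u ∈ (gs[m]).args, ∀ ws,
      (dOp base μOp u).eval (V0 ++ ws) = derivC μ (u.eval (gateValues (gs.take m))) := by
    intro u hu ws
    cases u with
    | var v =>
      rcases v with v | q
      · simp [dOp, Operand.eval, derivC_X_inl]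
      · obtain ⟨r, hr⟩ := hVpre
        show (μOp q).eval (V0 ++ ws) = derivC μ (X (Sum.inr q))
        rw [hr, List.append_assoc, hμ, derivC_X_inr]
    | const c => simp [dOp, Operand.eval, derivC_C]
    | gate j =>
      have hj : j < m := hwf' _ hu
      simp only [dOp, Operand.eval]
      rw [List.getD_eq_getElem?_getD, List.getElem?_append_left (by rw [hlen0]; omega),
        ← List.getD_eq_getElem?_getD, hV0, ih j hj, gateValues_take_eq_take, List.getD_eq_getElem?_getD,
        List.getD_eq_getElem?_getD, List.getElem?_take_of_lt hj]
  have hA0 : ∀ u ∈ (gs[m]).args, u.eval V0 = u.eval (gateValues (gs.take m)) :=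
    fun u hu => by simpa using hA u hu []
  have hB0 : ∀ u ∈ (gs[m]).args, (dOp base μOp u).eval V0 = derivC μ (u.eval (gateValues (gs.take m))) :=
    fun u hu => by simpa using hB u hu []
  rw [getD_gateValues_eq_eval_take gs hm]
  generalize hg : gs[m] = g at hwf' hfan' hA hB hA0 hB0 ⊢
  have hidx : base + 3 * m + 2 = V0.length + 2 := by omega
  rcases g with ⟨args⟩ | ⟨_ | ⟨u, _ | ⟨w, _ | ⟨x, rest⟩⟩⟩⟩
  · -- sum gate: the same linear combination of the derivatives
    rw [dBlock, gateValues_append_three, ← hV0, hidx, getD_append_three]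
    simp only [Gate.eval, List.map_map, Function.comp_def]
    rw [derivC_list_sum_smul]
    congr 1
    refine List.map_congr_left fun a ha => ?_
    rw [hB a.2 (by simpa [Gate.args] using ⟨a.1, ha⟩)]
  · -- empty product: value `1`, derivative `0`
    rw [dBlock, gateValues_append_three, ← hV0, hidx, getD_append_three]
    simp [zeroGate, Gate.eval, derivC_one]
  · -- unary product: value `u`, derivative `Du`
    have hu : u ∈ (Gate.prod [u] : Gate ℂ (GraphVars n)).args := by simp [Gate.args]
    rw [dBlock, gateValues_append_three, ← hV0, hidx, getD_append_three]
    simp only [Gate.eval, List.map_cons, List.map_nil, List.sum_cons, List.sum_nil, List.prod_cons,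
      List.prod_nil, one_smul, add_zero, mul_one]
    exact hB u hu _
  · -- binary product: Leibniz
    have hu : u ∈ (Gate.prod [u, w] : Gate ℂ (GraphVars n)).args := by simp [Gate.args]
    have hw : w ∈ (Gate.prod [u, w] : Gate ℂ (GraphVars n)).args := by simp [Gate.args]
    rw [dBlock, gateValues_append_three, ← hV0, hidx, getD_append_three]
    simp only [Gate.eval, List.map_cons, List.map_nil, List.sum_cons, List.sum_nil, List.prod_cons,
      List.prod_nil, one_smul, add_zero, mul_one, Operand.eval_gate]
    rw [show base + 3 * m + 1 = V0.length + 1 by omega, show base + 3 * m = V0.length by omega,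
      getD_append_two_fst, getD_append_two_snd, hB0 u hu, hA0 w hw, hA u hu, hB w hw, derivC_mul]
  · -- fan-in three or more: excluded
    simp [Gate.fanIn, Gate.args] at hfan'

/-- **THE INVARIANT.**  After the blocks of the first `m` gates, the derivative `D_μ v_i` of every
gate `i < m` of `E` sits at position `base + 3i + 2`. -/
theorem getD_dBlocks (μ : Fin n × Fin n → MvPolynomial (MatMulVars n) ℂ)
    {gs pre : List (Gate ℂ (GraphVars n))}
    (hwf : ∀ (i : ℕ) (g : Gate ℂ (GraphVars n)), gs[i]? = some g → ∀ u ∈ g.args, u.RefsBelow i)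
    (hfan : ∀ g ∈ gs, g.fanIn ≤ 2) (hpre : ∃ t, pre = gs ++ t) (hlen : pre.length = base)
    (hμ : ∀ q ws, (μOp q).eval (gateValues pre ++ ws) = liftAB n (μ q)) {m : ℕ} (hm : m ≤ gs.length)
    {i : ℕ} (hi : i < m) :
    (gateValues (pre ++ dBlocks base μOp gs m)).getD (base + 3 * i + 2) 0 =
      derivC μ ((gateValues gs).getD i 0) := by
  induction m generalizing i with
  | zero => omega
  | succ m ih =>
    have hm' : m < gs.length := hm
    have hall : dBlocks base μOp gs (m + 1) = dBlocks base μOp gs m ++ dBlock base μOp m gs[m] := by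
      simp [dBlocks, List.getD_eq_getElem?_getD, List.getElem?_eq_getElem hm']
    rw [hall, ← List.append_assoc]
    by_cases him : i < m
    · rw [EqSystem.getD_gateValues_append (by simp [hlen, dBlocks_length]; omega)]
      exact ih hm'.le him
    · obtain rfl : i = m := by omega
      exact getD_dBlock_step μ hwf hfan hpre hlen hμ hm' fun j hj => ih hm'.le hj

end AD

end Summit.MatrixMultiplication.MatrixMultiplication.Theorems.GraphEquations
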